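import Summits.CriticalPhenomena.PercolationContinuityZ3.Theorems.PercNearOneGluingNoHeavyPcintNawFreeZ4F10Defs
import HarnessLib

/-!
# PCINT lane, kernel reduced-state B2d (`nawfree`) certificate `Z4F10` (d = 4, memory τ = 10, delay kt = 4, 729 state classes): row checks 3 (rows [640, 729))

Cell `prim-pcint`, seat `prim-pcint-1` (gen 6); memo `run/shared/lean/prim/pcint/REDUCTIONS.md` §B2d (delayed chain payments with
free-neighbour shares).  Does NOT build on p205010.  Data for `NawK.le_siteCriticalProb_of_checkRowsF` (`…PcintNawFreeMemKernelCert`):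
`p = 17020/100000`, weight table `Q_k/100000`, `Q = [82980, 82980, 91094, 93971, 95443, 96338, 96939, 97370, 97695]` (`Q_k^k·100000 ≥ (100000-17020)·100000^k`, nondecreasing), `λ = 99999/100000`; Collatz–Wielandt
weights (scale 10⁹) from a power iteration, exact off-line max row ratio 0.9994740638 < λ.  Generated by work/gen6/gen_free.py
(pcint-1 gen 6 folder); the kernel re-checks every row.
-/

namespace Summit.CriticalPhenomena.PercolationContinuityZ3.Theorems.Pcint.NawFreeZ4F10

set_option maxHeartbeats 0 in
/-- Rows `[640, 680)` pass the check. [folklore] -/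
theorem chk_640 : WinK.allRange (NawK.checkRowF 10 4 4 729 17020 100000 99999 100000 NawFreeZ4F10.QL NawFreeZ4F10.syms NawFreeZ4F10.tree) 640 680 = true :=
  WinK.allRange_of_allRangeB (fuel := 8) (lo := 640) (len := 40) (by decide +kernel)

set_option maxHeartbeats 0 in
/-- Rows `[680, 720)` pass the check. [folklore] -/
theorem chk_680 : WinK.allRange (NawK.checkRowF 10 4 4 729 17020 100000 99999 100000 NawFreeZ4F10.QL NawFreeZ4F10.syms NawFreeZ4F10.tree) 680 720 = true :=
  WinK.allRange_of_allRangeB (fuel := 8) (lo := 680) (len := 40) (by decide +kernel)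

set_option maxHeartbeats 0 in
/-- Rows `[720, 729)` pass the check. [folklore] -/
theorem chk_720 : WinK.allRange (NawK.checkRowF 10 4 4 729 17020 100000 99999 100000 NawFreeZ4F10.QL NawFreeZ4F10.syms NawFreeZ4F10.tree) 720 729 = true :=
  WinK.allRange_of_allRangeB (fuel := 8) (lo := 720) (len := 9) (by decide +kernel)

/-- Rows `[640, 729)` pass the check. [folklore] -/
theorem file_3 : WinK.allRange (NawK.checkRowF 10 4 4 729 17020 100000 99999 100000 NawFreeZ4F10.QL NawFreeZ4F10.syms NawFreeZ4F10.tree) 640 729 = true := (WinK.allRange_split (WinK.allRange_split chk_640 chk_680) chk_720)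

end Summit.CriticalPhenomena.PercolationContinuityZ3.Theorems.Pcint.NawFreeZ4F10
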